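import Summits.ValiantsHypothesis.ValiantsHypothesis.Theorems.BarrierLeverPartitionMinorsHitByVPHiddenStatesCoreFree

/-!
# Route BarrierLever — item `PartitionMinorsHitByVP` (stmt-ValiantsHypothesis-19717), line `hidden_states`:
# the class «COMPLETE BALL ⊔ ANYTHING» is served by ONE legal design, for every `h`

Helper file (`--supports stmt-ValiantsHypothesis-19717`; cell valiant-natproofs, rung V4, 𝒟-side door (c); prover seat val-np-p6 gen 9).
Definition-free. Closes NO item. First application of the order-free «tiled core + free points» theorem
(`SymbJoin.symGood_core_free`, p602295).

**`SymbJoin.ballPlusFree_node`.** For every `h ≥ 1`, radius `t ≥ 1` and slack `F ≤ h + 1`, with `r = |B_t([h])| + F`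
(`|B_t([h])| = #{J ⊆ Fin h : |J| ≤ t} = Σ_{j ≤ t} C(h, j)`), there is ONE legal wide join threshold family — two pieces on `K = h` states:
the complete Hamming ball `{J : |J| ≤ t}` (offset `0`, unit weights) and the star `{∅} ∪ {{q} : q < F − 1}` (offset `t − 1`, unit weights on
the used states, weight `t + 2` on the others; offset `t + 1` when `F = 0`) — whose block-additive matrix is nonsingular at some table for
EVERY injective row family `u : Fin r → Finset (Fin h)` that CONTAINS THE BALL (`∀ J, |J| ≤ t → J ∈ range u`); the other `F` rows are
completely arbitrary. Stated in the shape of the line's node (`m ≤ 2h`, `K ≤ h³`, injective `e`, joint strict threshold,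
`∀ u in the class, ∃ tx, det ≠ 0`).

Proof: the ball piece tiles the ball rows (`Cst = ∅`, `σ = id`); a non-ball row is contained in no ball row (it would be a ball row); the
points of a star are affinely free (`φ = y_q` frees `{q}`, `φ = 1 − Σ_q y_q` frees `∅`); `symGood_core_free` does the rest. Ball-game
reading: the bare ball LOSES the cut-tree game against most down-sets of its size (census HOME/val-np-p6/g8 §4), but against «itself ⊔
anything» the mirror table needs no cut, and free points absorb the arbitrary part (ADD-ROW lemma, p601464).

WHAT THIS IS NOT: a class theorem (row families containing a complete ball, slack ≤ h + 1), not the node; item 19717 OPEN; nothing on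
crux 14610 or VP ≠ VNP.
-/

set_option linter.dupNamespace false

namespace Summit.ValiantsHypothesis.ValiantsHypothesis.Theorems.BarrierLever.HiddenStates

open Finset Matrix MvPolynomial

noncomputable section

namespace SymbJoin

/-- The `j`-th point of the star piece: `∅` for `j = 0`, `{j - 1}` otherwise. -/
theorem starPt_card_le_one {h F : ℕ} (hF : F ≤ h + 1) (j : Fin F) :
    (if hj : (j : ℕ) = 0 then (∅ : Finset (Fin h)) else {⟨(j : ℕ) - 1, by omega⟩}).card ≤ 1 := by
  split_ifs <;> simp

/-- The star enumeration is injective. -/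
theorem starPt_injective {h F : ℕ} (hF : F ≤ h + 1) :
    Function.Injective fun j : Fin F =>
      (if hj : (j : ℕ) = 0 then (∅ : Finset (Fin h)) else {⟨(j : ℕ) - 1, by omega⟩}) := by
  intro j j' hjj'
  simp only at hjj'
  by_cases hj : (j : ℕ) = 0 <;> by_cases hj' : (j' : ℕ) = 0
  · exact Fin.ext (by omega)
  · rw [dif_pos hj, dif_neg hj'] at hjj'
    exact absurd hjj'.symm (Finset.singleton_ne_empty _)
  · rw [dif_neg hj, dif_pos hj'] at hjj'
    exact absurd hjj' (Finset.singleton_ne_empty _)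
  · rw [dif_neg hj, dif_neg hj', Finset.singleton_inj, Fin.mk.injEq] at hjj'
    exact Fin.ext (by omega)

/-- The member set of the two-piece design «ball of radius `t` ⊔ star with `F` points» has `|B_t([h])| + F` elements. -/
theorem ballStar_members_card (h t F : ℕ) (hF : F ≤ h + 1) :
    ((Finset.univ.filter fun J : Finset (Fin h) => J.card ≤ t).image (fun J => ((0 : Fin 2), J)) ∪
      (Finset.univ : Finset (Fin F)).image (fun j : Fin F => ((1 : Fin 2),
        if hj : (j : ℕ) = 0 then (∅ : Finset (Fin h)) else {⟨(j : ℕ) - 1, by omega⟩}))).card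
      = (Finset.univ.filter fun J : Finset (Fin h) => J.card ≤ t).card + F := by
  classical
  rw [Finset.card_union_of_disjoint, Finset.card_image_of_injective _ (fun J J' hJ => by simpa using hJ),
    Finset.card_image_of_injective, Finset.card_univ, Fintype.card_fin]
  · intro j j' hjj'
    exact starPt_injective hF (by simpa using hjj')
  · rw [Finset.disjoint_left]
    intro x hx hx'
    obtain ⟨J, _, rfl⟩ := Finset.mem_image.mp hx
    obtain ⟨j, _, hj⟩ := Finset.mem_image.mp hx'
    have h01 := congrArg Prod.fst hj
    simp at h01

/-- **«COMPLETE BALL ⊔ ANYTHING» (node-shaped class theorem, all `h`).** See the module docstring. -/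
theorem ballPlusFree_node (h t F r : ℕ) (hh : 1 ≤ h) (ht : 1 ≤ t) (hF : F ≤ h + 1)
    (hr : r = (Finset.univ.filter fun J : Finset (Fin h) => J.card ≤ t).card + F) :
    ∃ (m K : ℕ) (W : Fin m → ℕ) (wt : Fin m → Fin K → ℕ) (e : Fin r → Fin m × Finset (Fin K)),
      m ≤ h + h ∧ K ≤ h * h * h ∧ Function.Injective e ∧
      (∀ x : Fin m × Finset (Fin K), x ∉ Set.range e →
        ∀ i, W (e i).1 + ∑ k ∈ (e i).2, wt (e i).1 k < W x.1 + ∑ k ∈ x.2, wt x.1 k) ∧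
      ∀ u : Fin r → Finset (Fin h), Function.Injective u → (∀ J : Finset (Fin h), J.card ≤ t → J ∈ Set.range u) →
        ∃ tx : Fin m → Option (Fin K) → Fin h → ℂ,
          (Matrix.of fun i k : Fin r =>
            ∏ a ∈ u i, (tx (e k).1 none a + ∑ q ∈ (e k).2, tx (e k).1 (some q) a)).det ≠ 0 := by
  classical
  -- the member set and its enumeration
  set Ball : Finset (Finset (Fin h)) := Finset.univ.filter fun J : Finset (Fin h) => J.card ≤ t with hBall
  have hBall_mem : ∀ J, J ∈ Ball ↔ J.card ≤ t := fun J => by rw [hBall, Finset.mem_filter]; simp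
  let star : Fin F → Finset (Fin h) := fun j =>
    if hj : (j : ℕ) = 0 then (∅ : Finset (Fin h)) else {⟨(j : ℕ) - 1, by omega⟩}
  have hstar_inj : Function.Injective star := starPt_injective hF
  have hstar_card : ∀ j, (star j).card ≤ 1 := starPt_card_le_one hF
  set S : Finset (Fin 2 × Finset (Fin h)) :=
    Ball.image (fun J => ((0 : Fin 2), J)) ∪ (Finset.univ : Finset (Fin F)).image (fun j => ((1 : Fin 2), star j)) with hS
  have hScard : S.card = r := by rw [hr, hS, hBall]; exact ballStar_members_card h t F hF
  let eqv : Fin r ≃ S := (Fin.castOrderIso hScard.symm).toEquiv.trans S.equivFin.symm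
  let e : Fin r → Fin 2 × Finset (Fin h) := fun i => (eqv i).1
  have he_mem : ∀ i, e i ∈ S := fun i => (eqv i).2
  have he_inj : Function.Injective e := fun i j hij => eqv.injective (Subtype.ext hij)
  have he_symm : ∀ y : S, e (eqv.symm y) = y.1 := fun y => by simp [e]
  have he_surj : ∀ x ∈ S, ∃ i, e i = x := fun x hx => ⟨eqv.symm ⟨x, hx⟩, he_symm _⟩
  have hmemS : ∀ x : Fin 2 × Finset (Fin h), x ∈ S ↔
      (x.1 = 0 ∧ x.2.card ≤ t) ∨ (x.1 = 1 ∧ ∃ j : Fin F, star j = x.2) := by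
    intro x
    rw [hS, Finset.mem_union, Finset.mem_image, Finset.mem_image]
    constructor
    · rintro (⟨J, hJ, rfl⟩ | ⟨j, _, rfl⟩)
      · exact Or.inl ⟨rfl, (hBall_mem J).mp hJ⟩
      · exact Or.inr ⟨rfl, j, rfl⟩
    · rintro (⟨h1, h2⟩ | ⟨h1, j, hj⟩)
      · exact Or.inl ⟨x.2, (hBall_mem _).mpr h2, by ext <;> simp [h1]⟩
      · exact Or.inr ⟨j, Finset.mem_univ _, by ext <;> simp [h1, hj]⟩
  have two_cases : ∀ p : Fin 2, p = 0 ∨ p = 1 := by decide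
  -- weights
  let W : Fin 2 → ℕ := fun p => if p = 0 then 0 else (if F = 0 then t + 1 else t - 1)
  let wt : Fin 2 → Fin h → ℕ := fun p q => if p = 0 then 1 else (if (q : ℕ) + 1 < F then 1 else t + 2)
  refine ⟨2, h, W, wt, e, by omega,
    le_trans (le_trans (Nat.le_mul_of_pos_right h hh) (Nat.le_mul_of_pos_right _ hh)) (le_of_eq (by ring)),
    he_inj, ?_, ?_⟩
  · -- joint strict threshold: used weights ≤ t < t + 1 ≤ unused weights
    intro x hx i
    have hxS : x ∉ S := fun hxS => by obtain ⟨j, hj⟩ := he_surj x hxS; exact hx ⟨j, hj⟩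
    have hi := (hmemS (e i)).mp (he_mem i)
    have hused : W (e i).1 + ∑ k ∈ (e i).2, wt (e i).1 k ≤ t := by
      rcases hi with ⟨h1, h2⟩ | ⟨h1, j, hj⟩
      · simp only [W, wt, h1, if_true, Finset.sum_const, smul_eq_mul, mul_one, zero_add]; exact h2
      · have hF0 : F ≠ 0 := by have := j.2; omega
        simp only [W, wt, h1, hF0, if_false, Fin.one_eq_zero_iff, OfNat.ofNat_ne_one, ← hj]
        by_cases hj0 : (j : ℕ) = 0
        · simp [star, hj0]
        · simp only [star, hj0, dif_neg, not_false_eq_true, Finset.sum_singleton]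
          rw [if_pos (by have := j.2; omega)]
          omega
    have hunused : t + 1 ≤ W x.1 + ∑ k ∈ x.2, wt x.1 k := by
      rw [hmemS] at hxS
      push Not at hxS
      rcases two_cases x.1 with hx1 | hx1
      · have hc := hxS.1 hx1
        simp only [W, wt, hx1, if_true, Finset.sum_const, smul_eq_mul, mul_one, zero_add]
        omega
      · have hne : ∀ j : Fin F, star j ≠ x.2 := hxS.2 hx1
        simp only [W, wt, hx1, Fin.one_eq_zero_iff, OfNat.ofNat_ne_one, if_false]
        by_cases hF0 : F = 0
        · rw [if_pos hF0]; omega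
        · rw [if_neg hF0]
          -- x.2 is not a star point: it is not ∅, not a light singleton
          have hge1 : ∀ k ∈ x.2, 1 ≤ (if (k : ℕ) + 1 < F then 1 else t + 2) := fun k _ => by split_ifs <;> omega
          have hsum_ge : x.2.card ≤ ∑ k ∈ x.2, (if (k : ℕ) + 1 < F then 1 else t + 2) := by
            have := Finset.card_nsmul_le_sum x.2 _ 1 hge1
            simpa using this
          have hne0 : x.2 ≠ ∅ := fun h0 => hne ⟨0, Nat.pos_of_ne_zero hF0⟩ (by simp [star, h0])
          rcases Nat.lt_or_ge x.2.card 2 with hc | hc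
          · -- card = 1: x.2 = {q} with q + 1 ≥ F (else it is the star point q + 1)
            have hc1 : x.2.card = 1 := by
              have := Finset.nonempty_iff_ne_empty.mpr hne0 |>.card_pos; omega
            obtain ⟨q, hq⟩ := Finset.card_eq_one.mp hc1
            have hqF : ¬ (q : ℕ) + 1 < F := fun hqF =>
              hne ⟨(q : ℕ) + 1, hqF⟩ (by simp [star, hq])
            rw [hq, Finset.sum_singleton, if_neg hqF]
            omega
          · omega
    omega
  · -- the class: families containing the ball
    intro u hu hball
    -- core rows / columns indexed by the ball
    set r₀ := Ball.card with hr₀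
    let gB : Fin r₀ ≃ Ball := Ball.equivFin.symm
    have hgB_card : ∀ c, ((gB c : Ball) : Finset (Fin h)).card ≤ t := fun c => (hBall_mem _).mp (gB c).2
    have hmem0 : ∀ c : Fin r₀, ((0 : Fin 2), ((gB c : Ball) : Finset (Fin h))) ∈ S := fun c =>
      (hmemS _).mpr (Or.inl ⟨rfl, hgB_card c⟩)
    let col : Fin r₀ → Fin r := fun c => eqv.symm ⟨_, hmem0 c⟩
    have hecol : ∀ c, e (col c) = ((0 : Fin 2), ((gB c : Ball) : Finset (Fin h))) := fun c => he_symm _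
    have hcol : Function.Injective col := by
      intro c c' hcc'
      have := congrArg e hcc'
      rw [hecol, hecol, Prod.mk.injEq] at this
      exact gB.injective (Subtype.ext this.2)
    have hrowex : ∀ c : Fin r₀, ∃ i, u i = ((gB c : Ball) : Finset (Fin h)) := fun c => by
      obtain ⟨i, hi⟩ := hball _ (hgB_card c); exact ⟨i, hi⟩
    choose row hurow using hrowex
    have hrow : Function.Injective row := by
      intro c c' hcc'
      have := hurow c
      rw [hcc', hurow c'] at this
      exact gB.injective (Subtype.ext this.symm)
    refine exists_table_of_core_free u hu e row col hrow hcol (fun _ => ∅) (fun _ q => q) ?_ ?_ ?_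
    · -- tiling: u (row c) = hidden set of col c
      intro c a
      rw [hurow c, hecol c]
      simp
    · -- a non-ball row is contained in no ball row
      intro i hi c hsub
      apply hi
      have hcard : (u i).card ≤ t := (Finset.card_le_card (by rw [hurow c] at hsub; exact hsub)).trans (hgB_card c)
      let c' : Fin r₀ := gB.symm ⟨u i, (hBall_mem _).mpr hcard⟩
      refine ⟨c', hu ?_⟩
      rw [hurow c']
      simp [c']
    · -- the star points are affinely free inside the star piece
      intro k hk
      have hkS := (hmemS (e k)).mp (he_mem k)
      rcases hkS with ⟨h1, h2⟩ | ⟨h1, j, hj⟩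
      · -- a ball column is a core column: contradiction
        exfalso; apply hk
        let c : Fin r₀ := gB.symm ⟨(e k).2, (hBall_mem _).mpr h2⟩
        refine ⟨c, he_inj ?_⟩
        rw [hecol c]
        ext <;> simp [c, h1]
      · -- star column `star j`
        have hother : ∀ k', k' ≠ k → (e k').1 = (e k).1 → ∃ j' : Fin F, j' ≠ j ∧ (e k').2 = star j' := by
          intro k' hk' hp
          have hk'S := (hmemS (e k')).mp (he_mem k')
          rcases hk'S with ⟨h1', _⟩ | ⟨_, j', hj'⟩
          · rw [hp, h1] at h1'; exact absurd h1' (by decide)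
          · refine ⟨j', fun hjj => hk' (he_inj ?_), hj'.symm⟩
            ext
            · rw [hp]
            · rw [← hj', ← hj, hjj]
        by_cases hj0 : (j : ℕ) = 0
        · -- the empty point: φ = 1 - Σ_q y_q
          refine ⟨fun o => Option.elim o 1 fun _ => -1, ?_, ?_⟩
          · rw [← hj]; simp [phi, star, hj0]
          · intro k' hk' hp
            obtain ⟨j', hj'ne, hk'2⟩ := hother k' hk' hp
            have hj'0 : (j' : ℕ) ≠ 0 := fun h0 => hj'ne (Fin.ext (by rw [h0, hj0]))
            rw [hk'2]; simp [phi, star, hj'0]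
        · -- the point {q}: φ = y_q
          refine ⟨fun o => Option.elim o 0 fun q' => if (q' : ℕ) = (j : ℕ) - 1 then 1 else 0, ?_, ?_⟩
          · rw [← hj]
            simp only [phi, star, dif_neg hj0, Finset.sum_singleton, Option.elim]
            simp
          · intro k' hk' hp
            obtain ⟨j', hj'ne, hk'2⟩ := hother k' hk' hp
            rw [hk'2]
            by_cases hj'0 : (j' : ℕ) = 0
            · simp [phi, star, hj'0]
            · have hne' : (j' : ℕ) - 1 ≠ (j : ℕ) - 1 := fun h' => hj'ne (Fin.ext (by omega))
              simp [phi, star, hj'0, hne']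

end SymbJoin

end

end Summit.ValiantsHypothesis.ValiantsHypothesis.Theorems.BarrierLever.HiddenStates
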